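import Summits.CriticalPhenomena.PercolationContinuityZ3.Theorems.PercNearOneGluingNoHeavyLowerTailSahiGridPatternPairCert
import Summits.CriticalPhenomena.PercolationContinuityZ3.Theorems.PercNearOneGluingNoHeavyLowerTailSahiGridPatternDiagCert
import Summits.CriticalPhenomena.PercolationContinuityZ3.Theorems.PercNearOneGluingNoHeavyLowerTailSahiGridPatternKleitman

/-!
# `NoHeavyLowerTail` (crux stmt-CriticalPhenomena-4575), Sahi programme P1: **THE Θ OF A BLOCK PRODUCT IS DOMINATED BY THE Θ_S-WEIGHTED Θ_V OF
# ITS SECTIONS** — `Θ_{S×V}(P×Q) ≤ Σ_{ξ,η} Θ_S(ξ,η)·Θ_V(P^ξ × Q^η)` for all up-sets `S, V, P, Q` (every `n, k`)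

Support file (Sahi cell, seat `prim-sahi-p1`, generation 29; `--supports stmt-CriticalPhenomena-4575`).  Pure proofs, no definitions, no `sorry`,
standard axioms.  Vocabulary of `…SahiGridPattern{,CellForm,CellAtoms,SliceForm,Kleitman}` (`Pd`, `glue`, `fibre`, `sect`, `ind`, `TotDist`, `thirdPt`,
`thetaVal`, `klCoef`, `sum_klCoef_ind_nonneg`).

THE MATHEMATICS.  Let `S ⊆ [3]^n`, `V ⊆ [3]^k` be up-sets and `A = S × V ⊆ [3]^{n+k}` (`glue ξ z ∈ A ↔ ξ ∈ S ∧ z ∈ V`).  The off-diagonal slice kernel of a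
first slot `U` is `Θ_U(x,y) = [x δ̸ y](1_U(x) + 1_U(y) − 1_U(z))`, `z` the third point of the Latin line through `x, y`; the diagonal-certificate condition (N)
asks `Θ_U(P×Q) ≤ d(P∩Q)`.  For glued points (`…DiagCertBlockAndT.thetaVal_blockAnd`, re-proved here to keep the two generation-29 files independent)
`Θ_A(glue ξ q, glue η r) = [ξ δ̸ η][q δ̸ r]·(1_S(ξ)1_V(q) + 1_S(η)1_V(r) − 1_S(ζ)1_V(m))`, and the POINTWISE IDENTITY (`theta_prod_sub_theta_blockAnd`)
   `Θ_S(ξ,η)·Θ_V(q,r) − Θ_A(glue ξ q, glue η r) = K_S(η;ξ)·K_V(q;r) + K_S(ξ;η)·K_V(r;q)`,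
   `K_U(q;r) := klCoef U q r = [r δ̸ q](1_U(r) − 1_U(q̄r))` (Kleitman coefficient),
turns the difference of the two sides into TWO PRODUCTS OF KLEITMAN SUMS: for up-sets `P, Q ⊆ [3]^{n+k}` with sections `P^ξ`, fibres `P_q`,
   `Σ_{ξ,η} Θ_S(ξ,η)·Θ_V(P^ξ×Q^η) − Θ_A(P×Q) = Σ_{η,q} [Σ_ξ K_S(η;ξ)1_{P_q}(ξ)]·[Σ_r K_V(q;r)1_{Q^η}(r)] + Σ_{ξ,r} [Σ_η K_S(ξ;η)1_{Q_r}(η)]·[Σ_q K_V(r;q)1_{P^ξ}(q)]`,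
every bracket `≥ 0` by Kleitman's lemma in the cube around a point (`sum_klCoef_ind_nonneg`, fibres and sections of up-sets being up-sets).
**THEOREM (`theta_blockAnd_le`, every `n, k`):**  `Σ_{x∈P, y∈Q} Θ_{S×V}(x,y) ≤ Σ_{ξ,η} Θ_S(ξ,η) · Σ_{q∈P^ξ, r∈Q^η} Θ_V(q,r)`.
USE.  This is the 'T3 ≥ 0' part of the block-AND certificate step of the seat memo FROM-prim-sahi-p1-gen29 §3: with a diagonal certificate `d` of `V`, (N) on the
section pairs bounds the right-hand side by `Σ_{ξ,η} Θ_S(ξ,η)·d(P^ξ∩Q^η)` on the pairs with `Θ_S ≥ 0`; the remaining bookkeeping (pairs with `Θ_S = −1`, and the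
comparison with `2^n Σ_{ξ∈S} d(P^ξ∩Q^ξ)`) is the finite S-block routing problem solved there for every Θ-Harris `S ⊆ [3]^j`, `j ≤ 2`.  For `S = ⊤` the theorem is
the equality-free form of the cylinder step (`Θ_⊤ = [δ̸]`).  Nothing here asserts `PatternPos d` for `d ≥ 4` or condition (N) for any block product. [this work]
-/

namespace Summit.CriticalPhenomena.PercolationContinuityZ3.Theorems.SahiGridPattern

open Finset SahiGrid3
open scoped BigOperators

variable {n k : ℕ} {S : Finset (Pd n)} {V : Finset (Pd k)} {A : Finset (Pd (n + k))}

/-- Indicator of the block product (local copy of `ind_glue_blockAnd`). -/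
private theorem ind_glue_blockAnd' (hA : ∀ ξ z, glue ξ z ∈ A ↔ (ξ ∈ S ∧ z ∈ V)) (ξ : Pd n) (z : Pd k) :
    ind A (glue ξ z) = ind S ξ * ind V z := by
  unfold ind
  simp only [hA]
  by_cases h1 : ξ ∈ S <;> by_cases h2 : z ∈ V <;> simp [h1, h2]

/-- **The pointwise identity**: `Θ_S(ξ,η)·Θ_V(q,r) − Θ_{S×V}(glue ξ q, glue η r) = K_S(η;ξ)·K_V(q;r) + K_S(ξ;η)·K_V(r;q)`. [this work] -/
theorem theta_prod_sub_theta_blockAnd (hA : ∀ ξ z, glue ξ z ∈ A ↔ (ξ ∈ S ∧ z ∈ V)) (ξ η : Pd n) (q r : Pd k) :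
    thetaVal S ξ η * thetaVal V q r - thetaVal A (glue ξ q) (glue η r) =
      klCoef S η ξ * klCoef V q r + klCoef S ξ η * klCoef V r q := by
  unfold thetaVal klCoef
  rw [thirdPt_glue, ind_glue_blockAnd' hA, ind_glue_blockAnd' hA, ind_glue_blockAnd' hA, totDist_symm r q, thirdPt_comm r q,
    totDist_symm η ξ, thirdPt_comm η ξ]
  by_cases h1 : TotDist ξ η = true
  · by_cases h2 : TotDist q r = true
    · simp only [if_pos h1, if_pos h2, if_pos ((totDist_glue ξ η q r).2 ⟨h1, h2⟩)]; ring
    · have hn : ¬ TotDist (glue ξ q) (glue η r) = true := fun h => h2 ((totDist_glue ξ η q r).1 h).2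
      simp only [if_pos h1, if_neg h2, if_neg hn]; ring
  · have hn : ¬ TotDist (glue ξ q) (glue η r) = true := fun h => h1 ((totDist_glue ξ η q r).1 h).1
    simp only [if_neg h1, if_neg hn]; ring

/-- `Θ_A(P×Q)` as a four-fold indicator sum over the two blocks. [this work] -/
theorem theta_pairs_eq_sum4 (P Q : Finset (Pd (n + k))) :
    (∑ x ∈ P, ∑ y ∈ Q, thetaVal A x y) =
      ∑ ξ : Pd n, ∑ q : Pd k, ∑ η : Pd n, ∑ r : Pd k, ind P (glue ξ q) * ind Q (glue η r) * thetaVal A (glue ξ q) (glue η r) := by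
  rw [sum_sum_mem_eq_ind, sum_glue]
  refine Finset.sum_congr rfl fun ξ _ => Finset.sum_congr rfl fun q _ => ?_
  rw [sum_glue]

/-- The weighted section sum as a four-fold indicator sum. [this work] -/
theorem theta_sections_eq_sum4 (P Q : Finset (Pd (n + k))) :
    (∑ ξ : Pd n, ∑ η : Pd n, thetaVal S ξ η * ∑ q ∈ sect P ξ, ∑ r ∈ sect Q η, thetaVal V q r) =
      ∑ ξ : Pd n, ∑ q : Pd k, ∑ η : Pd n, ∑ r : Pd k, ind P (glue ξ q) * ind Q (glue η r) * (thetaVal S ξ η * thetaVal V q r) := by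
  have h : ∀ ξ η : Pd n, thetaVal S ξ η * (∑ q ∈ sect P ξ, ∑ r ∈ sect Q η, thetaVal V q r) =
      ∑ q : Pd k, ∑ r : Pd k, ind P (glue ξ q) * ind Q (glue η r) * (thetaVal S ξ η * thetaVal V q r) := by
    intro ξ η
    rw [sum_mem_eq_sum_ind_mul (sect P ξ), Finset.mul_sum]
    refine Finset.sum_congr rfl fun q _ => ?_
    rw [sum_mem_eq_sum_ind_mul (sect Q η), Finset.mul_sum, Finset.mul_sum]
    refine Finset.sum_congr rfl fun r _ => ?_
    rw [ind_sect, ind_sect]; ring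
  simp_rw [h]
  refine Finset.sum_congr rfl fun ξ _ => ?_
  rw [Finset.sum_comm]

/-- A product of a Kleitman sum in the free block (against a fibre) and one in the cell block (against a section) is nonnegative. [this work] -/
theorem klProd_nonneg (hS : IsUpperSet (S : Set (Pd n))) (hV : IsUpperSet (V : Set (Pd k))) {P Q : Finset (Pd (n + k))}
    (hP : IsUpperSet (P : Set (Pd (n + k)))) (hQ : IsUpperSet (Q : Set (Pd (n + k)))) (η : Pd n) (q : Pd k) :
    0 ≤ (∑ ξ : Pd n, klCoef S η ξ * ind P (glue ξ q)) * (∑ r : Pd k, klCoef V q r * ind Q (glue η r)) := by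
  refine mul_nonneg ?_ ?_
  · have h := sum_klCoef_ind_nonneg hS (isUpperSet_fibre hP q) η
    have e : (∑ ξ : Pd n, klCoef S η ξ * ind (fibre P q) ξ) = ∑ ξ : Pd n, klCoef S η ξ * ind P (glue ξ q) :=
      Finset.sum_congr rfl fun ξ _ => by rw [ind_fibre]
    rw [← e]; exact h
  · have h := sum_klCoef_ind_nonneg hV (isUpperSet_sect hQ η) q
    have e : (∑ r : Pd k, klCoef V q r * ind (sect Q η) r) = ∑ r : Pd k, klCoef V q r * ind Q (glue η r) :=
      Finset.sum_congr rfl fun r _ => by rw [ind_sect]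
    rw [← e]; exact h

/-- **THEOREM (the Θ of a block product; every `n, k`).**  For up-sets `S ⊆ [3]^n`, `V ⊆ [3]^k`, `A = S × V` and up-sets `P, Q ⊆ [3]^{n+k}`:
`Σ_{x∈P} Σ_{y∈Q} Θ_A(x,y) ≤ Σ_ξ Σ_η Θ_S(ξ,η) · Σ_{q∈P^ξ} Σ_{r∈Q^η} Θ_V(q,r)`. [this work] -/
theorem theta_blockAnd_le (hA : ∀ ξ z, glue ξ z ∈ A ↔ (ξ ∈ S ∧ z ∈ V)) (hS : IsUpperSet (S : Set (Pd n))) (hV : IsUpperSet (V : Set (Pd k)))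
    {P Q : Finset (Pd (n + k))} (hP : IsUpperSet (P : Set (Pd (n + k)))) (hQ : IsUpperSet (Q : Set (Pd (n + k)))) :
    (∑ x ∈ P, ∑ y ∈ Q, thetaVal A x y) ≤ ∑ ξ : Pd n, ∑ η : Pd n, thetaVal S ξ η * ∑ q ∈ sect P ξ, ∑ r ∈ sect Q η, thetaVal V q r := by
  rw [theta_pairs_eq_sum4, theta_sections_eq_sum4]
  -- the difference, pointwise
  have hdiff : (∑ ξ : Pd n, ∑ q : Pd k, ∑ η : Pd n, ∑ r : Pd k, ind P (glue ξ q) * ind Q (glue η r) * (thetaVal S ξ η * thetaVal V q r)) -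
      (∑ ξ : Pd n, ∑ q : Pd k, ∑ η : Pd n, ∑ r : Pd k, ind P (glue ξ q) * ind Q (glue η r) * thetaVal A (glue ξ q) (glue η r)) =
      (∑ ξ : Pd n, ∑ q : Pd k, ∑ η : Pd n, ∑ r : Pd k, ind P (glue ξ q) * ind Q (glue η r) * (klCoef S η ξ * klCoef V q r)) +
      (∑ ξ : Pd n, ∑ q : Pd k, ∑ η : Pd n, ∑ r : Pd k, ind P (glue ξ q) * ind Q (glue η r) * (klCoef S ξ η * klCoef V r q)) := by
    rw [← Finset.sum_sub_distrib, ← Finset.sum_add_distrib]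
    refine Finset.sum_congr rfl fun ξ _ => ?_
    rw [← Finset.sum_sub_distrib, ← Finset.sum_add_distrib]
    refine Finset.sum_congr rfl fun q _ => ?_
    rw [← Finset.sum_sub_distrib, ← Finset.sum_add_distrib]
    refine Finset.sum_congr rfl fun η _ => ?_
    rw [← Finset.sum_sub_distrib, ← Finset.sum_add_distrib]
    refine Finset.sum_congr rfl fun r _ => ?_
    rw [← mul_sub, theta_prod_sub_theta_blockAnd hA, mul_add]
  -- first Kleitman product: group by (η, q)
  have hA1 : (∑ ξ : Pd n, ∑ q : Pd k, ∑ η : Pd n, ∑ r : Pd k, ind P (glue ξ q) * ind Q (glue η r) * (klCoef S η ξ * klCoef V q r)) =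
      ∑ q : Pd k, ∑ η : Pd n, (∑ ξ : Pd n, klCoef S η ξ * ind P (glue ξ q)) * (∑ r : Pd k, klCoef V q r * ind Q (glue η r)) := by
    rw [Finset.sum_comm]
    refine Finset.sum_congr rfl fun q _ => ?_
    rw [Finset.sum_comm]
    refine Finset.sum_congr rfl fun η _ => ?_
    rw [Finset.sum_mul_sum]
    refine Finset.sum_congr rfl fun ξ _ => Finset.sum_congr rfl fun r _ => ?_
    ring
  -- second Kleitman product: group by (ξ, r)
  have hA2 : (∑ ξ : Pd n, ∑ q : Pd k, ∑ η : Pd n, ∑ r : Pd k, ind P (glue ξ q) * ind Q (glue η r) * (klCoef S ξ η * klCoef V r q)) =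
      ∑ ξ : Pd n, ∑ r : Pd k, (∑ η : Pd n, klCoef S ξ η * ind Q (glue η r)) * (∑ q : Pd k, klCoef V r q * ind P (glue ξ q)) := by
    refine Finset.sum_congr rfl fun ξ _ => ?_
    rw [sum_comm3]
    refine Finset.sum_congr rfl fun r _ => ?_
    rw [Finset.sum_comm, Finset.sum_mul_sum]
    refine Finset.sum_congr rfl fun η _ => Finset.sum_congr rfl fun q _ => ?_
    ring
  have hpos1 : 0 ≤ ∑ q : Pd k, ∑ η : Pd n, (∑ ξ : Pd n, klCoef S η ξ * ind P (glue ξ q)) * (∑ r : Pd k, klCoef V q r * ind Q (glue η r)) :=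
    Finset.sum_nonneg fun q _ => Finset.sum_nonneg fun η _ => klProd_nonneg hS hV hP hQ η q
  have hpos2 : 0 ≤ ∑ ξ : Pd n, ∑ r : Pd k, (∑ η : Pd n, klCoef S ξ η * ind Q (glue η r)) * (∑ q : Pd k, klCoef V r q * ind P (glue ξ q)) :=
    Finset.sum_nonneg fun ξ _ => Finset.sum_nonneg fun r _ => klProd_nonneg hS hV hQ hP ξ r
  linarith [hdiff, hA1, hA2]

end Summit.CriticalPhenomena.PercolationContinuityZ3.Theorems.SahiGridPattern
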